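import Summits.QuantumFields.YangMills.Theorems.ColdStartUniversalityLatticeLangevinDuhamelSymmetry
import Summits.QuantumFields.YangMills.Theorems.ColdStartUniversalityLatticeLangevinFellerJoint
import Summits.QuantumFields.YangMills.Theorems.ColdStartUniversalityLatticeLangevinWilsonInvariant
import HarnessLib

/-!
# Route `ColdStartUniversality` (fixed-cut-off package): ★ the SU(2) lattice Langevin dynamics is REVERSIBLE with respect to
# the Wilson measure — the Shen–Zhu–Zhu semigroup is symmetric on `L²(μ_{β'})` (detailed balance), every coupling `β'`

Seat `ym-line-csu-p1`, g15.  Shen–Zhu–Zhu (CMP 400 (2023) §3, p. 13, after Lemma 3.3) introduce the Dirichlet form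
`𝓔^L(F,F) = Σ_e ∫ |∇_e F|² dμ` of the lattice Yang–Mills measure and assert «it is easy to see that `(P_t^L)` is a `μ`-version of
the `L²(μ)`-semigroup associated with `(𝓔^L, D(𝓔^L))`» — in particular `P_t^L` is SYMMETRIC (self-adjoint) on `L²(μ)`:

  `∫ F · P_t G dμ_{β'} = ∫ G · P_t F dμ_{β'}`        (`integral_mul_transition_symm_su2`, continuous `F, G`),

for `G = SU(2)`, `d = 3`, every torus size `L`, every coupling `β'` and every lattice time `t`; here `P_t G (x) = ∫ G d(κ_t x)`
for ANY Markov kernel family `κ` realising the transition laws of the SZZ system (`exists_transitionKernel`), equivalently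
`E[G(U^x_t)]` for any solution family on any filtered probability space (`integral_mul_markovTransition_symm_su2`).  The tree
had the INVARIANCE of `μ_{β'}` (`wilsonMeasureLangevinInvariant_su2`, seat g8 — the case `F = 1`) and the symmetry at `β' = 0`
(`integral_mul_transition_symm_beta_zero`); reversibility is strictly stronger and is the entrance to the `L²(μ)` spectral
calculus of the dynamics (variational spectral gap = Dirichlet form / variance, Kipnis–Varadhan, averaging).

Proof: no generator, core or integration by parts.  The ground-state Duhamel identity of seat g8 (`groundState_duhamel`: with
`φ = e^{-ψ̂/2}`, `q_t w := κ_t(φ w) = φ T_t w - ∫₀ᵗ q_s (V̂ T_{t-s} w) ds` on ridge functions, `T = κ⁰` the `β' = 0` kernels)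
is extended to all continuous `w` (`duhamel_first_of_dense`), turned around (`duhamel_second`) and fed to the bilinear Grönwall
argument `integral_mul_kernel_symm_of_duhamel` with the Haar symmetry of `κ⁰` (`integral_mul_transition_symm_beta_zero`) and
the joint continuity of the kernel actions (`continuous_transitionKernel_action`); the symmetric measure `φ⁻² Haar^E = e^{ψ̂} Haar^E`
is `μ_{β'}` up to normalisation (`integral_wilsonMeasure_eq_const_mul`).  THEOREMS ONLY, no definition, no sorry.  RECORD-rung
R3 plumbing at FIXED cut-off: this is not the K-uniform crux `NeutralColdStartMixing`, and the Yang–Mills mass gap is NOT proved.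
-/

set_option autoImplicit false

noncomputable section

namespace Summit.QuantumFields.YangMills.Theorems.ColdStartUniversality

open MeasureTheory ProbabilityTheory Finset Filter Set
open scoped BigOperators NNReal ENNReal
open Literature.Probability.Process Literature.MathematicalPhysics.QuantumFieldTheory Literature.Analysis.SpecialFunctions
open Literature.MathematicalPhysics.QuantumLattice (fundamentalRep fundamentalLatticeRep continuous_fundamentalRep)

variable {L : ℕ} [NeZero L]

/-- **The ground-state Duhamel identity in kernel form, on ridge functions** (first Duhamel form (D1) for the SU(2) SZZ
kernels): `κ_t(φ̂ w)(x) = φ̂(x) κ⁰_t w (x) - ∫₀ᵗ κ_s(φ̂ V̂ κ⁰_{t-s} w)(x) ds` for `w` in ridge form, `φ̂ = e^{-ψ̂/2}`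
(`groundState_duhamel` along the regular flow, read on any realising kernel families). [folklore] -/
theorem duhamel_first_ridge_kernel (β' : ℝ)
    (κ : ℝ≥0 → Kernel (GaugeConfig 3 L (Matrix.specialUnitaryGroup (Fin 2) ℂ))
      (GaugeConfig 3 L (Matrix.specialUnitaryGroup (Fin 2) ℂ))) [∀ t, IsMarkovKernel (κ t)]
    (hreal : ∀ (t : ℝ≥0) (x : GaugeConfig 3 L (Matrix.specialUnitaryGroup (Fin 2) ℂ))
        (Ω : Type) [MeasurableSpace Ω] (P : Measure Ω) [IsProbabilityMeasure P]
        (W : ℝ≥0 → Ω → (Edge 3 L × NoiseIdx 2 → ℝ)) (hW : IsFlatBrownian W P)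
        (U : ℝ≥0 → Ω → GaugeConfig 3 L (Matrix.specialUnitaryGroup (Fin 2) ℂ)),
        (∀ ω, U 0 ω = x) →
        (latticeLangevinDynamics (fundamentalLatticeRep 2) β').IsSolution (fundamentalRep (Fin 2))
          hW.natFiltration P W U →
        κ t x = P.map (U t))
    (κ₀ : ℝ≥0 → Kernel (GaugeConfig 3 L (Matrix.specialUnitaryGroup (Fin 2) ℂ))
      (GaugeConfig 3 L (Matrix.specialUnitaryGroup (Fin 2) ℂ))) [∀ t, IsMarkovKernel (κ₀ t)]
    (hreal₀ : ∀ (t : ℝ≥0) (x : GaugeConfig 3 L (Matrix.specialUnitaryGroup (Fin 2) ℂ))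
        (Ω : Type) [MeasurableSpace Ω] (P : Measure Ω) [IsProbabilityMeasure P]
        (W : ℝ≥0 → Ω → (Edge 3 L × NoiseIdx 2 → ℝ)) (hW : IsFlatBrownian W P)
        (U : ℝ≥0 → Ω → GaugeConfig 3 L (Matrix.specialUnitaryGroup (Fin 2) ℂ)),
        (∀ ω, U 0 ω = x) →
        (latticeLangevinDynamics (fundamentalLatticeRep 2) 0).IsSolution (fundamentalRep (Fin 2))
          hW.natFiltration P W U →
        κ₀ t x = P.map (U t))
    {ι : Type} [Fintype ι] (c : ι → ℝ) (g : ι → Edge 3 L → Matrix.specialUnitaryGroup (Fin 2) ℂ) (m : ι → Edge 3 L → ℕ)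
    (t : ℝ≥0) (x : GaugeConfig 3 L (Matrix.specialUnitaryGroup (Fin 2) ℂ)) :
    let ψV : GaugeConfig 3 L (Matrix.specialUnitaryGroup (Fin 2) ℂ) → ℝ := fun V =>
      β' * ∑ p : Plaquette 3 L, (rootedLoop (fun (e : Edge 3 L) (i j : Fin 2) =>
        ((((fundamentalRep (Fin 2) (V e) : Matrix (Fin 2) (Fin 2) ℂ) i j).re : ℝ) : ℂ) +
          ((((fundamentalRep (Fin 2) (V e) : Matrix (Fin 2) (Fin 2) ℂ) i j).im : ℝ) : ℂ) * Complex.I)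
        (p.1, p.2.1.1) p.2.1.2 false).trace.re
    let Vh : GaugeConfig 3 L (Matrix.specialUnitaryGroup (Fin 2) ℂ) → ℝ := fun V =>
      (let x : (Edge 3 L × Fin 2 × Fin 2 × Bool) → ℝ := fun q =>
          (fun z : ℂ => if q.2.2.2 then z.im else z.re)
            ((fundamentalRep (Fin 2) (V q.1) : Matrix (Fin 2) (Fin 2) ℂ) q.2.1 q.2.2.1)
       let b₀ : (Edge 3 L × Fin 2 × Fin 2 × Bool) → ℝ := fun q =>
          (fun z : ℂ => if q.2.2.2 then z.im else z.re) ((latticeLangevinDynamics (fundamentalLatticeRep 2) 0).drift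
            (matrixConfig (fundamentalRep (Fin 2)) V) q.1 q.2.1 q.2.2.1)
       let σ : (Edge 3 L × Fin 2 × Fin 2 × Bool) → (Edge 3 L × NoiseIdx 2) → ℝ := fun q k =>
          if k.1 = q.1 then (fun z : ℂ => if q.2.2.2 then z.im else z.re)
            ((latticeLangevinDynamics (fundamentalLatticeRep 2) 0).noise
              (matrixConfig (fundamentalRep (Fin 2)) V) q.1 k.2 q.2.1 q.2.2.1) else 0
       let ψ : ((Edge 3 L × Fin 2 × Fin 2 × Bool) → ℝ) → ℝ := fun y =>
          β' * ∑ p : Plaquette 3 L, (rootedLoop (fun (e : Edge 3 L) (i j : Fin 2) =>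
            ((y (e, i, j, false) : ℝ) : ℂ) + ((y (e, i, j, true) : ℝ) : ℂ) * Complex.I) (p.1, p.2.1.1) p.2.1.2 false).trace.re
       1 / 2 * (∑ i, fderiv ℝ ψ x (Pi.single i 1) * b₀ i +
            1 / 2 * ∑ i, ∑ j, fderiv ℝ (fun z => fderiv ℝ ψ z (Pi.single i 1)) x (Pi.single j 1) * ∑ n, σ i n * σ j n) +
          1 / 8 * ∑ i, ∑ j, fderiv ℝ ψ x (Pi.single i 1) * fderiv ℝ ψ x (Pi.single j 1) * ∑ n, σ i n * σ j n)
    ∫ y, Real.exp (-(1 / 2 : ℝ) * ψV y) *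
        (∑ l, c l * ∏ e, gegenbauerSum 1 (m l e) (hsForm 2 (fundamentalRep (Fin 2) (g l e)) (fundamentalRep (Fin 2) (y e)) / 2))
        ∂(κ t x) =
      Real.exp (-(1 / 2 : ℝ) * ψV x) *
          (∫ y, (∑ l, c l * ∏ e, gegenbauerSum 1 (m l e)
            (hsForm 2 (fundamentalRep (Fin 2) (g l e)) (fundamentalRep (Fin 2) (y e)) / 2)) ∂(κ₀ t x)) -
        ∫ s in (0 : ℝ)..(t : ℝ), ∫ y, Real.exp (-(1 / 2 : ℝ) * ψV y) * (Vh y *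
          ∫ z, (∑ l, c l * ∏ e, gegenbauerSum 1 (m l e)
            (hsForm 2 (fundamentalRep (Fin 2) (g l e)) (fundamentalRep (Fin 2) (z e)) / 2)) ∂(κ₀ ((t : ℝ) - s).toNNReal y))
          ∂(κ s.toNNReal x) := by
  intro ψV Vh
  classical
  haveI := secondCountableTopology_su2
  haveI := borelSpace_config L
  set φ : GaugeConfig 3 L (Matrix.specialUnitaryGroup (Fin 2) ℂ) → ℝ := fun V => Real.exp (-(1 / 2 : ℝ) * ψV V) with hφ
  set w : GaugeConfig 3 L (Matrix.specialUnitaryGroup (Fin 2) ℂ) → ℝ := fun V =>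
    ∑ l, c l * ∏ e, gegenbauerSum 1 (m l e) (hsForm 2 (fundamentalRep (Fin 2) (g l e)) (fundamentalRep (Fin 2) (V e)) / 2)
    with hw
  set Tw : ℝ → GaugeConfig 3 L (Matrix.specialUnitaryGroup (Fin 2) ℂ) → ℝ := fun τ V =>
      ∑ l, c l * Real.exp (-(∑ e, (m l e : ℝ) * ((m l e : ℝ) + 2) / 2) * τ) *
        ∏ e, gegenbauerSum 1 (m l e) (hsForm 2 (fundamentalRep (Fin 2) (g l e)) (fundamentalRep (Fin 2) (V e)) / 2) with hTw
  obtain ⟨-, -, hψc, -⟩ := exists_groundState_bounds (L := L) β'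
  have hψVc : Continuous ψV := hψc
  have hφc : Continuous φ := Real.continuous_exp.comp (continuous_const.mul hψVc)
  have hVc : Continuous Vh := continuous_groundStatePotential (L := L) β'
  have hFl : ∀ l, Continuous fun V : GaugeConfig 3 L (Matrix.specialUnitaryGroup (Fin 2) ℂ) =>
      ∏ e, gegenbauerSum 1 (m l e) (hsForm 2 (fundamentalRep (Fin 2) (g l e)) (fundamentalRep (Fin 2) (V e)) / 2) := fun l =>
    continuous_prod_gegenbauer_latitude (L := L) (g l) (m l)
  have hwc : Continuous w := continuous_finsetSum _ fun l _ => continuous_const.mul (hFl l)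
  have hTwc : ∀ τ, Continuous (Tw τ) := fun τ => continuous_finsetSum _ fun l _ => continuous_const.mul (hFl l)
  have hTw0 : ∀ V, Tw 0 V = w V := fun V => by
    simp only [hTw, mul_zero, Real.exp_zero, mul_one]; rfl
  -- the regular `β'`-flow on the product Wiener space realises `κ`
  haveI := isProbabilityMeasure_piWiener (Edge 3 L × NoiseIdx 2)
  have hWc := isFlatBrownian_piWiener 3 L (NoiseIdx 2)
  obtain ⟨X, GX, hX, hXm, -, -, -⟩ := exists_regularFlow L β' hWc
  have hPX : ∀ (s : ℝ≥0) (x : GaugeConfig 3 L (Matrix.specialUnitaryGroup (Fin 2) ℂ))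
      {F : GaugeConfig 3 L (Matrix.specialUnitaryGroup (Fin 2) ℂ) → ℝ}, Continuous F →
      ∫ y, F y ∂(κ s x) = ∫ ω, F (X x s ω) ∂(Measure.pi fun _ : Edge 3 L × NoiseIdx 2 => preWienerMeasure) := by
    intro s x F hF
    have hm : Measurable (X x s) := ((hX x).2.adapted s).mono (hWc.natFiltration.le s) le_rfl
    rw [hreal s x _ _ _ hWc (X x) (hX x).1 (hX x).2, integral_map hm.aemeasurable hF.aestronglyMeasurable]
  -- the ridge eigen-expansion `κ⁰_τ w = Tw τ`
  have hTwκ : ∀ (τ : ℝ≥0) (x : GaugeConfig 3 L (Matrix.specialUnitaryGroup (Fin 2) ℂ)), ∫ y, w y ∂(κ₀ τ x) = Tw τ x :=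
    fun τ x => integral_ridge_transitionKernel_beta_zero κ₀ hreal₀ c g m τ x
  -- Dynkin/Duhamel along the flow
  have hA := groundState_duhamel (L := L) β' hWc X hX hXm c g m x t
  obtain ⟨-, hA2⟩ := hA
  have ht0 : (0 : ℝ) ≤ t := t.2
  -- left-hand side
  have eL : ∫ y, φ y * w y ∂(κ t x) =
      ∫ ω, φ (X x t ω) * Tw 0 (X x t ω) ∂(Measure.pi fun _ : Edge 3 L × NoiseIdx 2 => preWienerMeasure) := by
    rw [hPX t x (F := fun y => φ y * w y) (hφc.mul hwc)]
    exact integral_congr_ae (Eventually.of_forall fun ω => by simp only [hTw0])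
  -- the time integrand, on `[0, t]`
  have eI : ∀ s ∈ uIcc (0 : ℝ) t,
      ∫ y, φ y * (Vh y * ∫ z, w z ∂(κ₀ ((t : ℝ) - s).toNNReal y)) ∂(κ s.toNNReal x) =
        ∫ ω, φ (X x s.toNNReal ω) * (Vh (X x s.toNNReal ω) * Tw ((t : ℝ) - s) (X x s.toNNReal ω))
          ∂(Measure.pi fun _ : Edge 3 L × NoiseIdx 2 => preWienerMeasure) := by
    intro s hs
    rw [uIcc_of_le ht0] at hs
    have hts : (((t : ℝ) - s).toNNReal : ℝ) = (t : ℝ) - s := Real.coe_toNNReal _ (sub_nonneg.2 hs.2)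
    have h1 : (fun y => φ y * (Vh y * ∫ z, w z ∂(κ₀ ((t : ℝ) - s).toNNReal y))) =
        fun y => φ y * (Vh y * Tw ((t : ℝ) - s) y) := by
      funext y; rw [hTwκ, hts]
    rw [h1]
    exact hPX _ x (hφc.mul (hVc.mul (hTwc _)))
  show ∫ y, φ y * w y ∂(κ t x) = φ x * (∫ y, w y ∂(κ₀ t x)) -
    ∫ s in (0 : ℝ)..(t : ℝ), ∫ y, φ y * (Vh y * ∫ z, w z ∂(κ₀ ((t : ℝ) - s).toNNReal y)) ∂(κ s.toNNReal x)
  rw [eL, hA2, hTwκ, intervalIntegral.integral_congr eI]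

/-- ★★ **Reversibility (detailed balance) of the SU(2) lattice Langevin dynamics with respect to the Wilson measure** — SZZ
§3 (p. 13): `P_t^L` is `μ_{β'}`-symmetric.  For every torus size `L`, coupling `β'`, lattice time `t`, every Markov kernel
family `κ` realising the transition laws of the Shen–Zhu–Zhu system, and continuous `F, G : SU(2)^E → ℝ`:
`∫ F(x) (∫ G dκ_t x) dμ_{β'}(x) = ∫ G(x) (∫ F dκ_t x) dμ_{β'}(x)`, `μ_{β'} = wilsonMeasure ρ_fund β'`.
[cite: ShenZhuZhu2022, §3 (Dirichlet form 𝓔^L and its L²(μ)-semigroup P_t^L, after Lemma 3.3, p. 13)] -/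
theorem integral_mul_transition_symm_su2 (L : ℕ) [NeZero L] (β' : ℝ)
    (κ : ℝ≥0 → Kernel (GaugeConfig 3 L (Matrix.specialUnitaryGroup (Fin 2) ℂ))
      (GaugeConfig 3 L (Matrix.specialUnitaryGroup (Fin 2) ℂ))) [∀ t, IsMarkovKernel (κ t)]
    (hreal : ∀ (t : ℝ≥0) (x : GaugeConfig 3 L (Matrix.specialUnitaryGroup (Fin 2) ℂ))
        (Ω : Type) [MeasurableSpace Ω] (P : Measure Ω) [IsProbabilityMeasure P]
        (W : ℝ≥0 → Ω → (Edge 3 L × NoiseIdx 2 → ℝ)) (hW : IsFlatBrownian W P)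
        (U : ℝ≥0 → Ω → GaugeConfig 3 L (Matrix.specialUnitaryGroup (Fin 2) ℂ)),
        (∀ ω, U 0 ω = x) →
        (latticeLangevinDynamics (fundamentalLatticeRep 2) β').IsSolution (fundamentalRep (Fin 2))
          hW.natFiltration P W U →
        κ t x = P.map (U t))
    (t : ℝ≥0) {F G : GaugeConfig 3 L (Matrix.specialUnitaryGroup (Fin 2) ℂ) → ℝ} (hF : Continuous F) (hG : Continuous G) :
    ∫ x, F x * (∫ y, G y ∂(κ t x)) ∂(wilsonMeasure (d := 3) (L := L) (fundamentalRep (Fin 2)) β') =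
      ∫ x, G x * (∫ y, F y ∂(κ t x)) ∂(wilsonMeasure (d := 3) (L := L) (fundamentalRep (Fin 2)) β') := by
  classical
  haveI := secondCountableTopology_su2
  haveI := borelSpace_config L
  haveI : IsProbabilityMeasure (haarProbability (Matrix.specialUnitaryGroup (Fin 2) ℂ)) := inferInstance
  obtain ⟨κ₀, hκ₀, -, hreal₀⟩ := exists_transitionKernel L 0
  haveI := hκ₀
  set π : Measure (GaugeConfig 3 L (Matrix.specialUnitaryGroup (Fin 2) ℂ)) :=
    Measure.pi fun _ : Edge 3 L => haarProbability (Matrix.specialUnitaryGroup (Fin 2) ℂ) with hπ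
  haveI : IsProbabilityMeasure π := by rw [hπ]; infer_instance
  -- the functions
  let ψV : GaugeConfig 3 L (Matrix.specialUnitaryGroup (Fin 2) ℂ) → ℝ := fun V =>
    β' * ∑ p : Plaquette 3 L, (rootedLoop (fun (e : Edge 3 L) (i j : Fin 2) =>
      ((((fundamentalRep (Fin 2) (V e) : Matrix (Fin 2) (Fin 2) ℂ) i j).re : ℝ) : ℂ) +
        ((((fundamentalRep (Fin 2) (V e) : Matrix (Fin 2) (Fin 2) ℂ) i j).im : ℝ) : ℂ) * Complex.I)
      (p.1, p.2.1.1) p.2.1.2 false).trace.re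
  let Vh : GaugeConfig 3 L (Matrix.specialUnitaryGroup (Fin 2) ℂ) → ℝ := fun V =>
    (let x : (Edge 3 L × Fin 2 × Fin 2 × Bool) → ℝ := fun q =>
        (fun z : ℂ => if q.2.2.2 then z.im else z.re)
          ((fundamentalRep (Fin 2) (V q.1) : Matrix (Fin 2) (Fin 2) ℂ) q.2.1 q.2.2.1)
     let b₀ : (Edge 3 L × Fin 2 × Fin 2 × Bool) → ℝ := fun q =>
        (fun z : ℂ => if q.2.2.2 then z.im else z.re) ((latticeLangevinDynamics (fundamentalLatticeRep 2) 0).drift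
          (matrixConfig (fundamentalRep (Fin 2)) V) q.1 q.2.1 q.2.2.1)
     let σ : (Edge 3 L × Fin 2 × Fin 2 × Bool) → (Edge 3 L × NoiseIdx 2) → ℝ := fun q k =>
        if k.1 = q.1 then (fun z : ℂ => if q.2.2.2 then z.im else z.re)
          ((latticeLangevinDynamics (fundamentalLatticeRep 2) 0).noise
            (matrixConfig (fundamentalRep (Fin 2)) V) q.1 k.2 q.2.1 q.2.2.1) else 0
     let ψ : ((Edge 3 L × Fin 2 × Fin 2 × Bool) → ℝ) → ℝ := fun y =>
        β' * ∑ p : Plaquette 3 L, (rootedLoop (fun (e : Edge 3 L) (i j : Fin 2) =>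
          ((y (e, i, j, false) : ℝ) : ℂ) + ((y (e, i, j, true) : ℝ) : ℂ) * Complex.I) (p.1, p.2.1.1) p.2.1.2 false).trace.re
     1 / 2 * (∑ i, fderiv ℝ ψ x (Pi.single i 1) * b₀ i +
          1 / 2 * ∑ i, ∑ j, fderiv ℝ (fun z => fderiv ℝ ψ z (Pi.single i 1)) x (Pi.single j 1) * ∑ n, σ i n * σ j n) +
        1 / 8 * ∑ i, ∑ j, fderiv ℝ ψ x (Pi.single i 1) * fderiv ℝ ψ x (Pi.single j 1) * ∑ n, σ i n * σ j n)
  let φ : GaugeConfig 3 L (Matrix.specialUnitaryGroup (Fin 2) ℂ) → ℝ := fun V => Real.exp (-(1 / 2 : ℝ) * ψV V)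
  let ρ : GaugeConfig 3 L (Matrix.specialUnitaryGroup (Fin 2) ℂ) → ℝ := fun V => Real.exp (ψV V)
  obtain ⟨-, -, hψc, -⟩ := exists_groundState_bounds (L := L) β'
  have hψVc : Continuous ψV := hψc
  have hφc : Continuous φ := Real.continuous_exp.comp (continuous_const.mul hψVc)
  have hφpos : ∀ V, 0 < φ V := fun V => Real.exp_pos _
  have hVc : Continuous Vh := continuous_groundStatePotential (L := L) β'
  have hρ : ∀ V, ρ V = (φ V)⁻¹ * (φ V)⁻¹ := fun V => by
    show Real.exp (ψV V) = (Real.exp (-(1 / 2 : ℝ) * ψV V))⁻¹ * (Real.exp (-(1 / 2 : ℝ) * ψV V))⁻¹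
    rw [← Real.exp_neg, ← Real.exp_add]
    congr 1; ring
  -- joint continuity of the two kernel actions (C₀-Feller)
  have hK : ∀ Gf : GaugeConfig 3 L (Matrix.specialUnitaryGroup (Fin 2) ℂ) → ℝ, Continuous Gf →
      Continuous fun p : ℝ≥0 × GaugeConfig 3 L (Matrix.specialUnitaryGroup (Fin 2) ℂ) => ∫ y, Gf y ∂(κ p.1 p.2) :=
    fun Gf hGf => continuous_transitionKernel_action β' κ hreal hGf
  have hT : ∀ Gf : GaugeConfig 3 L (Matrix.specialUnitaryGroup (Fin 2) ℂ) → ℝ, Continuous Gf →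
      Continuous fun p : ℝ≥0 × GaugeConfig 3 L (Matrix.specialUnitaryGroup (Fin 2) ℂ) => ∫ y, Gf y ∂(κ₀ p.1 p.2) :=
    fun Gf hGf => continuous_transitionKernel_action 0 κ₀ hreal₀ hGf
  -- Haar symmetry of the reference kernels
  have h0symm : ∀ (a : ℝ≥0) (F' G' : GaugeConfig 3 L (Matrix.specialUnitaryGroup (Fin 2) ℂ) → ℝ), Continuous F' → Continuous G' →
      ∫ x, F' x * ∫ y, G' y ∂(κ₀ a x) ∂π = ∫ x, G' x * ∫ y, F' y ∂(κ₀ a x) ∂π := by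
    intro a F' G' hF' hG'
    rw [hπ]
    exact integral_mul_transition_symm_beta_zero κ₀ hreal₀ a hF' hG'
  -- the ridge class and the first Duhamel form on it, then on all continuous observables
  let E : Set (GaugeConfig 3 L (Matrix.specialUnitaryGroup (Fin 2) ℂ) → ℝ) := {w |
    ∃ (ι : Type) (_ : Fintype ι) (c : ι → ℝ) (g : ι → Edge 3 L → Matrix.specialUnitaryGroup (Fin 2) ℂ)
      (m : ι → Edge 3 L → ℕ), ∀ V, w V = ∑ l, c l * ∏ e, gegenbauerSum 1 (m l e)
        (hsForm 2 (fundamentalRep (Fin 2) (g l e)) (fundamentalRep (Fin 2) (V e)) / 2)}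
  have hEc : ∀ w ∈ E, Continuous w := by
    rintro w ⟨ι, hι, c, g, m, hw⟩
    have h : w = fun V => ∑ l, c l * ∏ e, gegenbauerSum 1 (m l e)
        (hsForm 2 (fundamentalRep (Fin 2) (g l e)) (fundamentalRep (Fin 2) (V e)) / 2) := funext hw
    rw [h]
    exact continuous_finsetSum _ fun l _ => continuous_const.mul (continuous_prod_gegenbauer_latitude (L := L) (g l) (m l))
  have hEd : ∀ Gf : GaugeConfig 3 L (Matrix.specialUnitaryGroup (Fin 2) ℂ) → ℝ, Continuous Gf →
      ∀ ε : ℝ, 0 < ε → ∃ w ∈ E, ∀ x, |w x - Gf x| < ε := by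
    intro Gf hGf ε hε
    obtain ⟨ι, hι, c, g, m, h⟩ := exists_ridge_uniform_near (L := L) hGf hε
    exact ⟨fun V => ∑ l, c l * ∏ e, gegenbauerSum 1 (m l e)
      (hsForm 2 (fundamentalRep (Fin 2) (g l e)) (fundamentalRep (Fin 2) (V e)) / 2), ⟨ι, hι, c, g, m, fun V => rfl⟩, h⟩
  have hDE : ∀ w ∈ E, ∀ (s : ℝ≥0) (x : GaugeConfig 3 L (Matrix.specialUnitaryGroup (Fin 2) ℂ)),
      ∫ y, φ y * w y ∂(κ s x) = φ x * ∫ y, w y ∂(κ₀ s x) -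
        ∫ r in (0 : ℝ)..(s : ℝ), ∫ y, φ y * (Vh y * ∫ z, w z ∂(κ₀ ((s : ℝ) - r).toNNReal y)) ∂(κ r.toNNReal x) := by
    rintro w ⟨ι, hι, c, g, m, hw⟩ s x
    have hfun : w = fun V => ∑ l, c l * ∏ e, gegenbauerSum 1 (m l e)
        (hsForm 2 (fundamentalRep (Fin 2) (g l e)) (fundamentalRep (Fin 2) (V e)) / 2) := funext hw
    rw [hfun]
    exact duhamel_first_ridge_kernel (L := L) β' κ hreal κ₀ hreal₀ c g m s x
  have hD : ∀ w : GaugeConfig 3 L (Matrix.specialUnitaryGroup (Fin 2) ℂ) → ℝ, Continuous w →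
      ∀ (s : ℝ≥0) (x : GaugeConfig 3 L (Matrix.specialUnitaryGroup (Fin 2) ℂ)),
      ∫ y, φ y * w y ∂(κ s x) = φ x * ∫ y, w y ∂(κ₀ s x) -
        ∫ r in (0 : ℝ)..(s : ℝ), ∫ y, φ y * (Vh y * ∫ z, w z ∂(κ₀ ((s : ℝ) - r).toNNReal y)) ∂(κ r.toNNReal x) :=
    fun w hw s x => duhamel_first_of_dense κ κ₀ hK hT hφc hVc E hEc hEd hDE hw s x
  -- the abstract symmetry theorem, for the measure `e^{ψ̂} Haar^E`
  have hsymm := integral_mul_kernel_symm_of_duhamel κ κ₀ hK hT π h0symm hφc hφpos hVc hD hρ t hF hG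
  -- the Wilson measure is a constant multiple of `e^{ψ̂} Haar^E`
  obtain ⟨C, hC⟩ := integral_wilsonMeasure_eq_const_mul (L := L) β'
  rw [hC, hC]
  congr 1

/-- ★ **Reversibility in semigroup form**: for every flat Brownian motion on any probability space, every family `U` of
solutions of the SU(2) SZZ system from all deterministic starts, every lattice time `t` and continuous `F, G`,
`∫ F · P_t G dμ_{β'} = ∫ G · P_t F dμ_{β'}` with `P_t f (x) = E f(U^x_t)` (`markovTransition`). Equivalently: under the stationary
start `μ_{β'}` the pair `(U_0, U_t)` is exchangeable on observables of product form. [cite: ShenZhuZhu2022, §3 (p. 13)] -/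
theorem integral_mul_markovTransition_symm_su2 (L : ℕ) [NeZero L] (β' : ℝ)
    {Ω : Type} [MeasurableSpace Ω] {P : Measure Ω} [IsProbabilityMeasure P]
    {W : ℝ≥0 → Ω → (Edge 3 L × NoiseIdx 2 → ℝ)} (hW : IsFlatBrownian W P)
    (U : GaugeConfig 3 L (Matrix.specialUnitaryGroup (Fin 2) ℂ) → ℝ≥0 → Ω →
      GaugeConfig 3 L (Matrix.specialUnitaryGroup (Fin 2) ℂ))
    (hU : ∀ x, (∀ ω, U x 0 ω = x) ∧
      (latticeLangevinDynamics (fundamentalLatticeRep 2) β').IsSolution (fundamentalRep (Fin 2)) hW.natFiltration P W (U x))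
    (t : ℝ≥0) {F G : GaugeConfig 3 L (Matrix.specialUnitaryGroup (Fin 2) ℂ) → ℝ} (hF : Continuous F) (hG : Continuous G) :
    ∫ x, F x * markovTransition U P t G x ∂(wilsonMeasure (d := 3) (L := L) (fundamentalRep (Fin 2)) β') =
      ∫ x, G x * markovTransition U P t F x ∂(wilsonMeasure (d := 3) (L := L) (fundamentalRep (Fin 2)) β') := by
  classical
  haveI := secondCountableTopology_su2
  haveI := borelSpace_config L
  obtain ⟨κ, hκ, -, hreal⟩ := exists_transitionKernel L β'
  haveI := hκ
  have hm : ∀ x, Measurable (U x t) := fun x => ((hU x).2.adapted t).mono (hW.natFiltration.le t) le_rfl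
  have hκU : ∀ x, κ t x = P.map (U x t) := fun x => hreal t x _ P _ hW (U x) (hU x).1 (hU x).2
  have hPG : ∀ x, markovTransition U P t G x = ∫ y, G y ∂(κ t x) := fun x => by
    unfold markovTransition
    rw [hκU x, integral_map (hm x).aemeasurable hG.aestronglyMeasurable]
  have hPF : ∀ x, markovTransition U P t F x = ∫ y, F y ∂(κ t x) := fun x => by
    unfold markovTransition
    rw [hκU x, integral_map (hm x).aemeasurable hF.aestronglyMeasurable]
  simp_rw [hPG, hPF]
  exact integral_mul_transition_symm_su2 L β' κ hreal t hF hG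

end Summit.QuantumFields.YangMills.Theorems.ColdStartUniversality

end
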